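import Summits.AtomisticToContinuum.Crystallization.Theses.GappedShellCensus
import Summits.AtomisticToContinuum.Crystallization.Theorems.RadialDefectsVanish.Negative.FalseWithoutGS

/-!
# `CleanLimitExtractionR` (stmt-AtomisticToContinuum-18072), negative side: the conclusion is not free

Load-bearing analysis of the REPAIRED bridge crux of route `GappedShellCensus`,
`CleanLimitExtractionR := RadialDefectsVanish → ShellTrichotomy → TornFree → FiveFoldRationingR →
CleanLocalLimit` (disprover seat refuter-cdisprove-stmt-AtomisticToContinuum-18072-0).

The only hypothesis of the bridge that mentions the given sequence of clusters `x` is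
`RadialDefectsVanish`; the three geometric cruxes are closed statements about infinite
configurations.  This file records, kernel-checked and WITHOUT auxiliary definitions, that the
`x`-dependence is load-bearing:

* `cleanLimitExtractionR_iff` — `Iff.rfl` reading of the route decl with the conclusion of
  `CleanLocalLimit` written out for one sequence `x` (certifies that the body negated below is the
  route's conclusion verbatim);
* `cleanLocalLimit_conclusion_false_without_GS` — with every hypothesis on `x` dropped the
  conclusion is FALSE: the dilated line `x N i = 2i·e₀`
  (`RadialDefectsVanish.Negative.dilatedLine`, the tree's witness that the radial conclusion is not
  free either) has no clean local limit — a clean `Y ∋ 0` has two shell neighbours `w₁ ≠ w₂` of `0`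
  in the ball of radius `1.02a ≤ 51/50`, pairwise `≥ 0.98a ≥ 0.92` apart; `1/10`-matching
  `0, w₁, w₂` to particles of a translate of the line gives three particles with pairwise distances
  in `(0.72, 2.24) ∩ 2ℕ = {2}`, i.e. three naturals pairwise differing by exactly one — absurd.

Hence the bridge cannot be closed from the conclusion side, and (none of its four antecedents being
refuted, `ledger negatives` 2026-08-17) not ex falso either: a proof must feed
`RadialDefectsVanish` for the given `x` into the extraction — as the kernel-checked candidate
`Cruxes/CleanLimitExtractionR/SketchIdeator2.lean:cleanLimitExtractionR_candidate` does.
(This supersedes `Theorems/CleanLimitExtraction/Negative/ConclusionNotFree.lean` of the pre-repair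
crux stmt-15933, whose `cleanLimitExtraction_iff` mentions the decls `CleanLimitExtraction` /
`ShellCensus` dropped from the route file at rev 5 and therefore no longer elaborates.)

No route item is concluded positively here; no definitions are introduced.
-/

noncomputable section

open Literature.MathematicalPhysics.StatisticalMechanics

namespace Summit.AtomisticToContinuum.Crystallization.Theorems.CleanLimitExtractionR.Negative

open Summit.AtomisticToContinuum.Crystallization.Theses.GappedShellCensus
open Summit.AtomisticToContinuum.Crystallization.Theorems
open Filter

/-- `Iff.rfl` reading of the crux: the conclusion `CleanLocalLimit`, unfolded for one sequence `x`
(body verbatim from the route decl). -/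
theorem cleanLimitExtractionR_iff :
    CleanLimitExtractionR ↔ (RadialDefectsVanish → ShellTrichotomy → TornFree → FiveFoldRationingR →
      ∀ x : (N : ℕ) → (Fin N → EuclideanSpace ℝ (Fin 3)),
        (∀ N, IsGroundState lennardJones (x N)) →
        ∃ (Y : Set (EuclideanSpace ℝ (Fin 3))) (a : ℝ), 47 / 50 ≤ a ∧ a ≤ 1 ∧ (0 : EuclideanSpace ℝ (Fin 3)) ∈ Y ∧ (∃ (φ : ℕ → ℕ) (t : ℕ → EuclideanSpace ℝ (Fin 3)), StrictMono φ ∧ ∀ R ε : ℝ, 0 < ε → ∀ᶠ n in Filter.atTop, (∀ y ∈ Y, ‖y‖ ≤ R → ∃ i : Fin (φ n), dist (x (φ n) i + t n) y ≤ ε) ∧ (∀ i : Fin (φ n), ‖x (φ n) i + t n‖ ≤ R → ∃ y ∈ Y, dist (x (φ n) i + t n) y ≤ ε)) ∧ ∀ y ∈ Y, ({w ∈ Y | w ≠ y ∧ dist y w ≤ a * (1 + 1 / 50)}.ncard = 12 ∧ ∀ w ∈ Y, w ≠ y → a * (1 - 1 / 50) ≤ dist y w ∧ (dist y w ≤ a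 * (1 + 1 / 50) ∨ a * (63 / 50) ≤ dist y w)) ∧ ∃ T : Finset (EuclideanSpace ℝ (Fin 3)), (↑T : Set (EuclideanSpace ℝ (Fin 3))) = (fun w => a⁻¹ • (w - y)) '' {w ∈ Y | w ≠ y ∧ dist y w ≤ a * (1 + 1 / 50)} ∧ (Literature.Geometry.DiscreteGeometry.ShellCloseTo (1 / 5) T Literature.Geometry.DiscreteGeometry.fccKissingPattern ∨ Literature.Geometry.DiscreteGeometry.ShellCloseTo (1 / 5) T Literature.Geometry.DiscreteGeometry.hcpKissingPattern)) :=
  Iff.rfl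

/-- **The conclusion of the bridge is not free.**  `CleanLocalLimit` with EVERY hypothesis on the
sequence `x` dropped (in the bridge: `RadialDefectsVanish` for `x`, the only antecedent mentioning
`x`) is false — the dilated line `x N i = 2i·e₀` has no clean local limit.  Any proof of
`CleanLimitExtractionR` must therefore consume `RadialDefectsVanish` on the given `x`. -/
theorem cleanLocalLimit_conclusion_false_without_GS :
    ¬ ∀ x : (N : ℕ) → (Fin N → EuclideanSpace ℝ (Fin 3)),
        ∃ (Y : Set (EuclideanSpace ℝ (Fin 3))) (a : ℝ), 47 / 50 ≤ a ∧ a ≤ 1 ∧ (0 : EuclideanSpace ℝ (Fin 3)) ∈ Y ∧ (∃ (φ : ℕ → ℕ) (t : ℕ → EuclideanSpace ℝ (Fin 3)), StrictMono φ ∧ ∀ R ε : ℝ, 0 < ε → ∀ᶠ n in Filter.atTop, (∀ y ∈ Y, ‖y‖ ≤ R → ∃ i : Fin (φ n), dist (x (φ n) i + t n) y ≤ ε) ∧ (∀ i : Fin (φ n), ‖x (φ n) i + t n‖ ≤ R → ∃ y ∈ Y, dist (x (φ n) i + t n) y ≤ ε)) ∧ ∀ y ∈ Y, ({w ∈ Y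 | w ≠ y ∧ dist y w ≤ a * (1 + 1 / 50)}.ncard = 12 ∧ ∀ w ∈ Y, w ≠ y → a * (1 - 1 / 50) ≤ dist y w ∧ (dist y w ≤ a * (1 + 1 / 50) ∨ a * (63 / 50) ≤ dist y w)) ∧ ∃ T : Finset (EuclideanSpace ℝ (Fin 3)), (↑T : Set (EuclideanSpace ℝ (Fin 3))) = (fun w => a⁻¹ • (w - y)) '' {w ∈ Y | w ≠ y ∧ dist y w ≤ a * (1 + 1 / 50)} ∧ (Literature.Geometry.DiscreteGeometry.ShellCloseTo (1 / 5) T Literature.Geometry.DiscreteGeometry.fccKissingPattern ∨ Literature.Geometry.DiscreteGeometry.ShellCloseTo (1 / 5) T Literature.Geometry.DiscreteGeometry.hcpKissingPattern) := by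
  intro h
  -- integer step: if `2|i - j| ∈ (0.7, 2.3)` for naturals `i, j`, then `i - j = ±1`
  -- (inlined; the landed copy in `CleanLimitExtraction.Negative` lives in a module that no longer
  -- elaborates against the rev-5 route file)
  have int_step : ∀ i j : ℕ, (0.7 : ℝ) < 2 * |(i : ℝ) - (j : ℝ)| → 2 * |(i : ℝ) - (j : ℝ)| < 2.3 →
      (i : ℤ) - (j : ℤ) = 1 ∨ (i : ℤ) - (j : ℤ) = -1 := by
    intro i j hlo hhi
    have hcast : (i : ℝ) - (j : ℝ) = (((i : ℤ) - (j : ℤ) : ℤ) : ℝ) := by push_cast; ring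
    rw [hcast] at hlo hhi
    generalize hm : (i : ℤ) - (j : ℤ) = m at hlo hhi
    rw [← Int.cast_abs] at hlo hhi
    have h1 : ((|m| : ℤ) : ℝ) < 2 := by linarith
    have h2 : (0 : ℝ) < ((|m| : ℤ) : ℝ) := by linarith
    have h3 : |m| < 2 := by exact_mod_cast h1
    have h4 : 0 < |m| := by exact_mod_cast h2
    rcases abs_cases m with ⟨h, _⟩ | ⟨h, _⟩ <;> rw [h] at h3 h4 <;> omega
  obtain ⟨Y, a, ha1, ha2, h0, ⟨φ, t, -, hlim⟩, hgood⟩ := h RadialDefectsVanish.Negative.dilatedLine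
  -- two distinct shell neighbours `w₁ ≠ w₂` of the origin
  obtain ⟨⟨hcount, hsep0⟩, -⟩ := hgood 0 h0
  have hS0 : {w ∈ Y | w ≠ 0 ∧ dist 0 w ≤ a * (1 + 1 / 50)}.ncard ≠ 0 := by rw [hcount]; norm_num
  have hS1 : 1 < {w ∈ Y | w ≠ 0 ∧ dist 0 w ≤ a * (1 + 1 / 50)}.ncard := by rw [hcount]; norm_num
  obtain ⟨w₁, hw₁Y, hw₁0, hw₁d⟩ := Set.nonempty_of_ncard_ne_zero hS0
  obtain ⟨w₂, ⟨hw₂Y, hw₂0, hw₂d⟩, hne⟩ := Set.exists_ne_of_one_lt_ncard hS1 w₁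
  have hsep01 : a * (1 - 1 / 50) ≤ dist 0 w₁ := (hsep0 w₁ hw₁Y hw₁0).1
  have hsep02 : a * (1 - 1 / 50) ≤ dist 0 w₂ := (hsep0 w₂ hw₂Y hw₂0).1
  obtain ⟨⟨-, hsep1⟩, -⟩ := hgood w₁ hw₁Y
  have hsep12 : a * (1 - 1 / 50) ≤ dist w₁ w₂ := (hsep1 w₂ hw₂Y hne).1
  have hup12 : dist w₁ w₂ ≤ dist 0 w₁ + dist 0 w₂ := by
    calc dist w₁ w₂ ≤ dist w₁ 0 + dist 0 w₂ := dist_triangle _ _ _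
      _ = dist 0 w₁ + dist 0 w₂ := by rw [dist_comm w₁ 0]
  -- matching at radius `51/50`, tolerance `1/10`, at SOME index `n`
  obtain ⟨n, hn1, -⟩ := (hlim (51 / 50) (1 / 10) (by norm_num)).exists
  have hnorm : ∀ w : EuclideanSpace ℝ (Fin 3), dist 0 w ≤ a * (1 + 1 / 50) → ‖w‖ ≤ 51 / 50 := by
    intro w hw
    rw [← dist_zero_right, dist_comm]
    nlinarith
  obtain ⟨i₀, hi₀⟩ := hn1 0 h0 (by norm_num)
  obtain ⟨i₁, hi₁⟩ := hn1 w₁ hw₁Y (hnorm w₁ hw₁d)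
  obtain ⟨i₂, hi₂⟩ := hn1 w₂ hw₂Y (hnorm w₂ hw₂d)
  -- particle distances are `2|i - j|`
  have hpart : ∀ i j : Fin (φ n),
      dist (RadialDefectsVanish.Negative.dilatedLine (φ n) i + t n)
        (RadialDefectsVanish.Negative.dilatedLine (φ n) j + t n) =
        2 * |((i : ℕ) : ℝ) - ((j : ℕ) : ℝ)| := by
    intro i j
    rw [dist_add_right, RadialDefectsVanish.Negative.dist_dilatedLine]
  -- |dist p q - dist y z| ≤ dist p y + dist q z
  have hkey : ∀ (p q y z : EuclideanSpace ℝ (Fin 3)), dist p y ≤ 1 / 10 → dist q z ≤ 1 / 10 →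
      dist y z - 2 / 10 ≤ dist p q ∧ dist p q ≤ dist y z + 2 / 10 := by
    intro p q y z hp hq
    have h := dist_dist_dist_le p q y z
    rw [Real.dist_eq] at h
    constructor <;> linarith [(abs_sub_le_iff.1 (h.trans (add_le_add hp hq))).1,
      (abs_sub_le_iff.1 (h.trans (add_le_add hp hq))).2]
  obtain ⟨l01, u01⟩ := hkey _ _ _ _ hi₀ hi₁
  obtain ⟨l02, u02⟩ := hkey _ _ _ _ hi₀ hi₂
  obtain ⟨l12, u12⟩ := hkey _ _ _ _ hi₁ hi₂
  rw [hpart] at l01 u01 l02 u02 l12 u12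
  have s01 := int_step (i₀ : ℕ) (i₁ : ℕ) (by nlinarith) (by nlinarith)
  have s02 := int_step (i₀ : ℕ) (i₂ : ℕ) (by nlinarith) (by nlinarith)
  have s12 := int_step (i₁ : ℕ) (i₂ : ℕ) (by nlinarith) (by nlinarith)
  omega

end Summit.AtomisticToContinuum.Crystallization.Theorems.CleanLimitExtractionR.Negative

end
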